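import Literature.Geometry.Manifold.GermCechDescent
import Literature.Geometry.Kaehler.StrataDDbarDescent
import Literature.Geometry.Manifold.StrataNbhdTautnessComplex
import HarnessLib

/-!
# From the `∂∂̄`-descent on the strata to exactness near their union

Topic `Literature/Geometry/Kaehler`. The analytic heart of the direct route to P. Deligne,
*Théorie de Hodge III* (1974), Prop. 8.2.7 / Cor. 8.2.8 on compact Kähler manifolds: let
`T : StrataMaps M EP P` be a strata system (`StrataDDbarDescent`) over a compact complex manifold
`M` whose strata `P I` are compact Kähler manifolds EMBEDDED in `M` (`emb I` injective) and such
that the stratum of a finite set of indices is the INTERSECTION of the strata of its members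
(`range (emb I) = ⋂_{i ∈ I} range (emb {i})`, as for the iterated intersections of the components
of a simple normal crossing divisor). Then:

* `StrataMaps.germCechSystem` — the strata system is a germ Čech system
  (`Literature.Geometry.Manifold.GermCechSystem` of `GermCechDescent`): the modules of smooth
  ungraded complex forms on the strata, restriction = pull-back, and the two TAUTNESS properties of
  the embedded compact strata (`StrataNbhdTautnessComplex`: Spanier (1966), Thm. 6.1.10 through de
  Rham's theorem on open subsets, Bredon (1993), Thm. V.9.5);
* `StrataMaps.exists_nhd_restr_mem_localExactForms_of_isOfType` — **a closed form of pure type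
  `(p+1, q+1)` on `M` whose restriction to every `P {i}` is exact is exact on an open
  neighbourhood of `⋃ i, emb(P {i})`**: the `∂∂̄`-descent tower of `StrataDDbarDescent`
  (DGMS (1975), §5) is fed to the germ Čech descent `GermCechSystem.exists_isExactOn`
  (generalized Mayer–Vietoris for the closed cover by the strata, Bott–Tu (1982), Prop. 8.5/8.8 at
  the level of germs);
* `StrataMaps.exists_nhd_restr_mem_localExactForms_of_sres_eq_zero` /
  `StrataMaps.exists_nhd_restr_eq_zero_of_sres_eq_zero` — the same for a closed form (of any
  degree) whose restrictions to the `P {i}` VANISH (the zero tower), e.g. forms of type `(0, q)`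
  or `(p, 0)` with exact restrictions.

Everything is proved; no named facts (D-0026).

## References

* [DeligneHodgeIII1974] P. Deligne, *Théorie de Hodge III*, Publ. Math. IHÉS 44 (1974), 8.2.7–8.2.8.
* [DeligneGriffithsMorganSullivan1975] P. Deligne, Ph. Griffiths, J. Morgan, D. Sullivan, *Real
  homotopy theory of Kähler manifolds*, Invent. Math. 29 (1975), §§5–6.
* [BottTu1982Forms] R. Bott, L. W. Tu, *Differential Forms in Algebraic Topology* (1982), §8,
  Prop. 8.5, Prop. 8.8.
* [Spanier1981] E. H. Spanier, *Algebraic Topology*, Springer 1981, Ch. 6 §1, Thm. 10.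
* [Bredon1993] G. E. Bredon, *Topology and Geometry*, GTM 139 (1993), Thm. V.9.5.
-/

noncomputable section

open scoped Manifold ContDiff Topology
open Set Function Literature.Geometry.Manifold Literature.NumberTheory.Transcendental
open _root_.Topology

-- The identification `TangentSpace I x = E` is an abuse of definitional equality (see
-- `NormedSpace.fromTangentSpace`); as in Mathlib's tangent-bundle files we let `isDefEq` unfold it.
set_option backward.isDefEq.respectTransparency false

universe u

/-! ### §1 Smooth ungraded forms, their differential and pull-back -/

namespace Literature.Geometry.Manifold

open Literature.Geometry.Kaehler

section SmoothUForms

variable {E : Type*} [NormedAddCommGroup E] [NormedSpace ℝ E] {H : Type*} [TopologicalSpace H]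
  {I : ModelWithCorners ℝ E H} {M : Type*} [TopologicalSpace M] [ChartedSpace H M]
  {E' : Type*} [NormedAddCommGroup E'] [NormedSpace ℝ E'] {H' : Type*} [TopologicalSpace H']
  {I' : ModelWithCorners ℝ E' H'} {N : Type*} [TopologicalSpace N] [ChartedSpace H' N]
  {E'' : Type*} [NormedAddCommGroup E''] [NormedSpace ℝ E''] {H'' : Type*} [TopologicalSpace H'']
  {I'' : ModelWithCorners ℝ E'' H''} {N' : Type*} [TopologicalSpace N'] [ChartedSpace H'' N']
  {F : Type*} [NormedAddCommGroup F] [NormedSpace ℝ F]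

variable (I M F) in
/-- The `ℝ`-submodule of smooth ungraded forms (smooth in every degree). [cite: BottTu1982Forms, §I.1] -/
def smoothUForms : Submodule ℝ (UForm I M F) where
  carrier := {f | ∀ k, IsSmoothForm (f k)}
  add_mem' hf hg k := (hf k).add (hg k)
  zero_mem' _ := isSmoothForm_zero
  smul_mem' c _ hf k := (hf k).smul c

/-- Membership in `smoothUForms`. [folklore] -/
theorem mem_smoothUForms_iff {f : UForm I M F} : f ∈ smoothUForms I M F ↔ ∀ k, IsSmoothForm (f k) :=
  Iff.rfl

namespace UForm

/-- The (global) exterior derivative of an ungraded form, degreewise; the degree-`0` component is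
`0`. [cite: BottTu1982Forms, §I.1] -/
def d (f : UForm I M F) : UForm I M F := fun k ↦
  match k with
  | 0 => 0
  | k + 1 => mextDeriv (f k)

/-- The degree-`0` component of `d f` vanishes. [folklore] -/
@[simp] theorem d_zero_apply (f : UForm I M F) : d f 0 = 0 := rfl

/-- The positive-degree components of `d f`. [folklore] -/
@[simp] theorem d_succ_apply (f : UForm I M F) (k : ℕ) : d f (k + 1) = mextDeriv (f k) := rfl

/-- `D_U f = (d f)|_U`. [folklore] -/
theorem D_eq_restr_d (U : Set M) (f : UForm I M F) : D U f = restr U (d f) := by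
  funext k
  cases k with
  | zero => exact (MForm.restr_zero (I := I) (M := M) (F := F) (k := 0) U).symm
  | succ k => rfl

/-- `D_univ = d`. [folklore] -/
theorem D_univ (f : UForm I M F) : D univ f = d f := by
  rw [D_eq_restr_d]
  funext k
  exact MForm.restr_univ _

/-- A single form placed in degree `n` (zero in the other degrees). [folklore] -/
def single (n : ℕ) (x : MForm I M F n) : UForm I M F := fun k ↦ if h : n = k then x.castDeg h else 0

/-- The degree-`n` component of `single n x` is `x`. [folklore] -/
@[simp] theorem single_apply_self (n : ℕ) (x : MForm I M F n) : single n x n = x := by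
  simp [single]

/-- The other components of `single n x` vanish. [folklore] -/
theorem single_apply_of_ne {n k : ℕ} (h : n ≠ k) (x : MForm I M F n) : single n x k = 0 := by
  simp [single, h]

end UForm

/-- A form of degree exceeding the (real) dimension of the model vanishes. [folklore] -/
theorem mform_eq_zero_of_finrank_lt [FiniteDimensional ℝ E] {k : ℕ} (hk : Module.finrank ℝ E < k)
    (α : MForm I M F k) : α = 0 := by
  funext x
  have h : ∀ v : Fin k → TangentSpace I x, ¬ LinearIndependent ℝ v := fun v hv ↦ by
    have h1 := hv.fintype_card_le_finrank
    simp only [Fintype.card_fin] at h1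
    exact absurd (h1 : k ≤ Module.finrank ℝ E) (not_le.2 hk)
  ext v
  simpa using (α x).map_linearDependent v (h v)

namespace smoothUForms

variable [IsManifold I ∞ M] [IsManifold I' ∞ N] [IsManifold I'' ∞ N']

/-- **The differential on smooth ungraded forms**, an `ℝ`-linear endomorphism (`d` is additive on
smooth forms). [cite: BottTu1982Forms, §I.1] -/
def dS : smoothUForms I M F →ₗ[ℝ] smoothUForms I M F where
  toFun f := ⟨UForm.d (f : UForm I M F), fun k ↦ by
    cases k with
    | zero => exact isSmoothForm_zero
    | succ k => exact isSmoothForm_mextDeriv (inChart_mextDeriv_holds _ _ _) (f.2 k)⟩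
  map_add' f g := by
    refine Subtype.ext (funext fun k ↦ ?_)
    cases k with
    | zero => simp
    | succ k => exact mextDeriv_add (f.2 k) (g.2 k)
  map_smul' c f := by
    refine Subtype.ext (funext fun k ↦ ?_)
    cases k with
    | zero => simp
    | succ k => exact mextDeriv_smul c (f.1 k)

/-- `dS`, unfolded. [folklore] -/
@[simp] theorem coe_dS (f : smoothUForms I M F) : ((dS f : smoothUForms I M F) : UForm I M F) = UForm.d f :=
  rfl

/-- `dS ∘ dS = 0`. [cite: BottTu1982Forms, §I.1] -/
theorem dS_dS (f : smoothUForms I M F) : dS (dS f) = 0 := by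
  refine Subtype.ext (funext fun k ↦ ?_)
  match k with
  | 0 => rfl
  | 1 => exact mextDeriv_zero
  | k + 2 => exact mextDeriv_mextDeriv (inChart_mextDeriv_holds _ _ _) (f.2 k)

/-- **Pull-back of smooth ungraded forms along a `C^∞` map**, an `ℝ`-linear map.
[cite: BottTu1982Forms, §I.2] -/
def pullbackS {φ : N → M} (hφ : ContMDiff I' I ∞ φ) : smoothUForms I M F →ₗ[ℝ] smoothUForms I' N F where
  toFun f := ⟨fun k ↦ (f.1 k).pullback I' φ, fun k ↦ isSmoothForm_pullback hφ (f.2 k)⟩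
  map_add' _ _ := Subtype.ext (funext fun _ ↦ MForm.pullback_add _ _ _)
  map_smul' _ _ := Subtype.ext (funext fun _ ↦ MForm.pullback_smul _ _ _)

/-- `pullbackS`, in a degree. [folklore] -/
@[simp] theorem pullbackS_apply {φ : N → M} (hφ : ContMDiff I' I ∞ φ) (f : smoothUForms I M F) (k : ℕ) :
    ((pullbackS hφ f : smoothUForms I' N F) : UForm I' N F) k = (f.1 k).pullback I' φ :=
  rfl

/-- Pull-back commutes with `dS` (`d f^* = f^* d` on smooth forms). [cite: BottTu1982Forms, §I.2] -/
theorem pullbackS_dS {φ : N → M} (hφ : ContMDiff I' I ∞ φ) (f : smoothUForms I M F) :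
    pullbackS hφ (dS f) = dS (pullbackS (F := F) hφ f) := by
  refine Subtype.ext (funext fun k ↦ ?_)
  cases k with
  | zero => exact MForm.pullback_zero _
  | succ k => exact (mextDeriv_pullback hφ (f.2 k)).symm

omit [IsManifold I ∞ M] [IsManifold I' ∞ N] [IsManifold I'' ∞ N'] in
/-- Pointwise functoriality of the pull-back of forms. [folklore] -/
theorem _root_.Literature.Geometry.Kaehler.MForm.pullback_pullback_of_mdifferentiable {k : ℕ}
    (β : MForm I M F k) {g : N → M} {f : N' → N} (hg : MDifferentiable I' I g)
    (hf : MDifferentiable I'' I' f) :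
    (β.pullback I' g).pullback I'' f = β.pullback I'' (g ∘ f) := by
  funext x
  ext V
  simp only [MForm.pullback_apply, mfderiv_comp x (hg (f x)) (hf x)]
  rfl

omit [IsManifold I ∞ M] in
/-- Pull-back along the identity. [folklore] -/
theorem _root_.Literature.Geometry.Kaehler.MForm.pullback_id' {k : ℕ} (β : MForm I M F k) :
    β.pullback I (id : M → M) = β := by
  funext x
  ext V
  simp only [MForm.pullback_apply, mfderiv_id]
  rfl

/-- Functoriality of `pullbackS`. [folklore] -/
theorem pullbackS_pullbackS {g : N → M} (hg : ContMDiff I' I ∞ g) {f : N' → N} (hf : ContMDiff I'' I' ∞ f)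
    (z : smoothUForms I M F) :
    pullbackS hf (pullbackS hg z) = pullbackS (F := F) (hg.comp hf) z :=
  Subtype.ext (funext fun k ↦ MForm.pullback_pullback_of_mdifferentiable _
    (hg.mdifferentiable (by simp)) (hf.mdifferentiable (by simp)))

/-- `pullbackS` only depends on the map. [folklore] -/
theorem pullbackS_congr {f g : N → M} (hf : ContMDiff I' I ∞ f) (hg : ContMDiff I' I ∞ g) (h : f = g)
    (z : smoothUForms I M F) : pullbackS hf z = pullbackS (F := F) hg z := by
  subst h; rfl

/-- Pull-back along the identity map. [folklore] -/
theorem pullbackS_id {f : M → M} (hf : ContMDiff I I ∞ f) (h : f = id) (z : smoothUForms I M F) :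
    pullbackS (F := F) hf z = z := by
  subst h
  exact Subtype.ext (funext fun k ↦ MForm.pullback_id' _)

end smoothUForms

/-- Pull-back respects differences. [folklore] -/
theorem mform_pullback_sub {k : ℕ} (α β : MForm I M F k) (φ : N → M) :
    (α - β).pullback I' φ = α.pullback I' φ - β.pullback I' φ := by
  funext y
  ext V
  simp [MForm.pullback_apply]

/-- The pull-back of a form only depends on its values on the range of the map. [folklore] -/
theorem _root_.Literature.Geometry.Kaehler.MForm.pullback_congr_of_forall_range {k : ℕ} {α β : MForm I M F k} {φ : N → M}
    (h : ∀ y, α (φ y) = β (φ y)) : α.pullback I' φ = β.pullback I' φ := by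
  funext y
  ext V
  simp only [MForm.pullback_apply, h y]

end SmoothUForms

end Literature.Geometry.Manifold

/-! ### §2 The germ Čech system of an embedded strata system -/

namespace Literature.Geometry.Kaehler

open Literature.Geometry.Manifold

section Strata

variable {ι : Type} [LinearOrder ι]
  {EM : Type u} [NormedAddCommGroup EM] [NormedSpace ℂ EM] [FiniteDimensional ℂ EM]
  {M : Type u} [TopologicalSpace M] [ChartedSpace EM M] [IsManifold 𝓘(ℝ, EM) ∞ M]
  [CompactSpace M] [T2Space M] [SecondCountableTopology M]
  {EP : Finset ι → Type u} [∀ I, NormedAddCommGroup (EP I)] [∀ I, NormedSpace ℂ (EP I)]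
  [∀ I, FiniteDimensional ℂ (EP I)]
  {P : Finset ι → Type u} [∀ I, TopologicalSpace (P I)] [∀ I, ChartedSpace (EP I) (P I)]
  [∀ I, IsManifold 𝓘(ℝ, EP I) ∞ (P I)]
  [∀ I, CompactSpace (P I)] [∀ I, T2Space (P I)] [∀ I, SecondCountableTopology (P I)]

variable (EP P) in
/-- **The forms of the germ Čech system**: smooth ungraded complex forms on the stratum of the
support of the tuple. [cite: BottTu1982Forms, §8 (8.1)] -/
abbrev TT {p : ℕ} (J : Fin p → ι) : Type u :=
  ↥(smoothUForms 𝓘(ℝ, EP (tupleSupport J)) (P (tupleSupport J)) ℂ)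

namespace StrataMaps

variable (T : StrataMaps (EM := EM) M EP P)

/-- The support of `J ∘ θ` is contained in the support of `J` (a form convenient for rewriting
along an equation of tuples). [folklore] -/
theorem tupleSupport_subset_of_eq {p q : ℕ} {J' : Fin p → ι} {J : Fin q → ι} {θ : Fin p → Fin q}
    (h : J' = J ∘ θ) : tupleSupport J' ⊆ tupleSupport J := by
  rw [h]; exact tupleSupport_comp_subset J θ

/-- The support of a `1`-tuple. [folklore] -/
theorem tupleSupport_fin_one (J : Fin 1 → ι) : tupleSupport J = {J 0} := by
  ext i
  simp only [tupleSupport, Finset.mem_image, Finset.mem_univ, true_and, Finset.mem_singleton]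
  exact ⟨fun ⟨x, hx⟩ ↦ by rw [Subsingleton.elim x 0] at hx; exact hx.symm, fun h ↦ ⟨0, h.symm⟩⟩

/-- `{J m} ⊆ tupleSupport J`. [folklore] -/
theorem singleton_subset_tupleSupport {p : ℕ} (J : Fin p → ι) (m : Fin p) :
    ({J m} : Finset ι) ⊆ tupleSupport J :=
  Finset.singleton_subset_iff.2 (mem_tupleSupport J m)


/-- Restriction of forms along a map of tuples: pull-back along `res`. [cite: BottTu1982Forms, §8] -/
def germRes {p q : ℕ} (J' : Fin p → ι) (J : Fin q → ι) (θ : Fin p → Fin q) (h : J' = J ∘ θ) :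
    TT EP P J' →ₗ[ℝ] TT EP P J :=
  smoothUForms.pullbackS (T.contMDiff_res (tupleSupport_subset_of_eq h))

/-- Restriction of an ambient ungraded form to a stratum: pull-back along `emb` when the result is
smooth, `0` otherwise (a bare function, additive on forms smooth near the stratum). [cite: BottTu1982Forms, §8 (8.5)] -/
def germR {p : ℕ} (J : Fin p → ι) (f : UForm 𝓘(ℝ, EM) M ℂ) : TT EP P J := by
  classical
  exact if hf : ∀ k, IsSmoothForm ((f k).pullback 𝓘(ℝ, EP (tupleSupport J)) (T.emb (tupleSupport J)))
    then ⟨fun k ↦ (f k).pullback 𝓘(ℝ, EP (tupleSupport J)) (T.emb (tupleSupport J)), hf⟩ else 0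

omit [FiniteDimensional ℂ EM] [IsManifold 𝓘(ℝ, EM) ∞ M] [CompactSpace M] [T2Space M]
  [SecondCountableTopology M] [∀ (I : Finset ι), FiniteDimensional ℂ (EP I)]
 
  [∀ (I : Finset ι), IsManifold 𝓘(ℝ, EP I) ∞ (P I)] [∀ (I : Finset ι), CompactSpace (P I)]
  [∀ (I : Finset ι), T2Space (P I)] [∀ (I : Finset ι), SecondCountableTopology (P I)] in
/-- `germR` on a form whose pull-back is smooth. [folklore] -/
theorem germR_of_smooth {p : ℕ} (J : Fin p → ι) {f : UForm 𝓘(ℝ, EM) M ℂ}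
    (hf : ∀ k, IsSmoothForm ((f k).pullback 𝓘(ℝ, EP (tupleSupport J)) (T.emb (tupleSupport J)))) :
    T.germR J f = ⟨fun k ↦ (f k).pullback 𝓘(ℝ, EP (tupleSupport J)) (T.emb (tupleSupport J)), hf⟩ := by
  classical
  simp only [germR, dif_pos hf]

omit [FiniteDimensional ℂ EM] [IsManifold 𝓘(ℝ, EM) ∞ M] [CompactSpace M] [T2Space M]
  [SecondCountableTopology M] [∀ I, FiniteDimensional ℂ (EP I)]
  [∀ I, IsManifold 𝓘(ℝ, EP I) ∞ (P I)]
  [∀ I, CompactSpace (P I)] [∀ I, T2Space (P I)] [∀ I, SecondCountableTopology (P I)] in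
/-- `germR` on a form whose pull-back is smooth, in a degree. [folklore] -/
theorem germR_apply_of_smooth {p : ℕ} (J : Fin p → ι) {f : UForm 𝓘(ℝ, EM) M ℂ}
    (hf : ∀ k, IsSmoothForm ((f k).pullback 𝓘(ℝ, EP (tupleSupport J)) (T.emb (tupleSupport J)))) (k : ℕ) :
    ((T.germR J f : TT EP P J) : UForm _ _ ℂ) k = (f k).pullback 𝓘(ℝ, EP (tupleSupport J)) (T.emb (tupleSupport J)) := by
  rw [germR_of_smooth T J hf]

variable (hinj : ∀ I : Finset ι, Injective (T.emb I))

section Range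

omit [FiniteDimensional ℂ EM] [IsManifold 𝓘(ℝ, EM) ∞ M] [CompactSpace M] [T2Space M]
  [SecondCountableTopology M] [∀ I, FiniteDimensional ℂ (EP I)]
  [∀ I, IsManifold 𝓘(ℝ, EP I) ∞ (P I)] [∀ I, CompactSpace (P I)] [∀ I, T2Space (P I)]
  [∀ I, SecondCountableTopology (P I)]

omit [LinearOrder ι] in
/-- The range of `emb` shrinks along `res`: `emb J (P J) ⊆ emb I (P I)` for `I ⊆ J`. [folklore] -/
theorem range_emb_subset {I J : Finset ι} (h : I ⊆ J) : range (T.emb J) ⊆ range (T.emb I) := by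
  rintro _ ⟨y, rfl⟩
  exact ⟨T.res h y, congrFun (T.emb_comp_res h) y⟩

end Range

omit [LinearOrder ι] [FiniteDimensional ℂ EM] [CompactSpace M] [T2Space M]
  [SecondCountableTopology M] [∀ (I : Finset ι), FiniteDimensional ℂ (EP I)]
  [∀ (I : Finset ι), CompactSpace (P I)]
  [∀ (I : Finset ι), T2Space (P I)] [∀ (I : Finset ι), SecondCountableTopology (P I)] in
/-- The pull-backs of an ambient form to a stratum along `emb` are smooth as soon as the form is
smooth at the points of an open set containing the image. [cite: WarnerGTM94, 2.22] -/
theorem isSmoothForm_pullback_emb_of_smoothAt {I : Finset ι} {W : Set M} (hKW : range (T.emb I) ⊆ W)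
    {k : ℕ} {α : MForm 𝓘(ℝ, EM) M ℂ k} (hα : ∀ x ∈ W, α.SmoothAt x) :
    IsSmoothForm (α.pullback 𝓘(ℝ, EP I) (T.emb I)) := fun y ↦
  MForm.SmoothAt.pullback (Filter.Eventually.of_forall fun z ↦ (T.contMDiff_emb I z))
    (hα _ (hKW ⟨y, rfl⟩))

/-! #### The tautness properties of the embedded compact strata, ungraded -/

section Taut

variable {I₀ : Finset ι}

omit [LinearOrder ι] [FiniteDimensional ℂ EM] [IsManifold 𝓘(ℝ, EM) ∞ M] [CompactSpace M]
  [SecondCountableTopology M] [∀ (I : Finset ι), FiniteDimensional ℂ (EP I)]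
 
  [∀ (I : Finset ι), IsManifold 𝓘(ℝ, EP I) ∞ (P I)] [∀ (I : Finset ι), T2Space (P I)]
  [∀ (I : Finset ι), SecondCountableTopology (P I)] in
include hinj in
/-- `emb I` is a topological embedding (an injective continuous map from a compact space to a
Hausdorff space). [folklore] -/
theorem isEmbedding_emb (I : Finset ι) : IsEmbedding (T.emb I) :=
  ((T.contMDiff_emb I).continuous.isClosedEmbedding (hinj I)).isEmbedding

omit [LinearOrder ι] in
include hinj in
/-- **Tautness I, ungraded.** A closed ungraded form `f` on an open `W ⊇ emb I (P I)` whose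
pull-back to `P I` is `d` of a smooth ungraded form is exact on some open `W'` with
`emb I (P I) ⊆ W' ⊆ W` (degree by degree by `StrataNbhdTautnessComplex`, finitely many degrees
carrying non-zero forms). [cite: Spanier1981, Ch. 6 §1, Thm. 10] [cite: Bredon1993, Thm. V.9.5] -/
theorem taut₁_emb (I : Finset ι) {W : Set M} (hW : IsOpen W) (hKW : range (T.emb I) ⊆ W)
    {f : UForm 𝓘(ℝ, EM) M ℂ} (hf : UForm.IsSmoothOn W f) (hdf : UForm.D W f = 0)
    (ζ : UForm 𝓘(ℝ, EP I) (P I) ℂ) (hζ : ∀ k, IsSmoothForm (ζ k))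
    (he : ∀ k, (f k).pullback 𝓘(ℝ, EP I) (T.emb I) = UForm.d ζ k) :
    ∃ W' : Set M, IsOpen W' ∧ range (T.emb I) ⊆ W' ∧ W' ⊆ W ∧ UForm.IsExactOn W' (UForm.restr W' f) := by
  haveI : FiniteDimensional ℝ EM := FiniteDimensional.complexToReal EM
  have hfW : ∀ y, T.emb I y ∈ W := fun y ↦ hKW ⟨y, rfl⟩
  have hemb := T.isEmbedding_emb hinj I
  have hclosed : ∀ k, f k ∈ localClosedForms 𝓘(ℝ, EM) ℂ k W := fun k ↦ by
    refine ⟨hf k, fun x hx ↦ ?_⟩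
    have := congrFun (congrFun hdf (k + 1)) x
    change ((mextDeriv (f k)).restr W) x = 0 at this
    rwa [MForm.restr_apply_of_mem _ hx] at this
  -- degree `0`
  obtain ⟨V₀, hV₀o, hV₀W, hKV₀, h0⟩ := exists_nhd_restr_eq_zero_of_pullback_eq_zero_complex
    (T.contMDiff_emb I) hemb hW hfW (hclosed 0) (by rw [he 0]; rfl)
  -- positive degrees: primitives on neighbourhoods
  have hpos : ∀ k : ℕ, ∃ (V : Set M) (hV : IsOpen V), V ⊆ W ∧ range (T.emb I) ⊆ V ∧
      (f (k + 1)).restr V ∈ localExactForms 𝓘(ℝ, EM) ℂ hV (k + 1) := fun k ↦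
    exists_nhd_restr_mem_localExactForms_of_pullback_eq_mextDeriv_complex (T.contMDiff_emb I) hemb hW
      hfW (hclosed (k + 1)) (hζ k) (by rw [he (k + 1)]; rfl)
  choose V hVo hVW hKV hex using hpos
  set N : ℕ := Module.finrank ℝ EM with hN
  set W' : Set M := V₀ ∩ ⋂ k ∈ Finset.range (N + 1), V k with hW'
  have hW'o : IsOpen W' := hV₀o.inter (isOpen_biInter_finset fun k _ ↦ hVo k)
  have hW'V : ∀ k, k ≤ N → W' ⊆ V k := fun k hk ↦
    inter_subset_right.trans (biInter_subset_of_mem (Finset.mem_range.2 (Nat.lt_succ_of_le hk)))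
  refine ⟨W', hW'o, subset_inter hKV₀ (subset_iInter₂ fun k _ ↦ hKV k), inter_subset_left.trans hV₀W, ?_⟩
  -- the primitives
  have hprim : ∀ k, ∃ g : smoothFormsOn 𝓘(ℝ, EM) ℂ (V k) k,
      (localD 𝓘(ℝ, EM) ℂ k (hVo k) g : MForm 𝓘(ℝ, EM) M ℂ (k + 1)) = (f (k + 1)).restr (V k) := fun k ↦
    (mem_localExactForms_succ_iff (hVo k)).1 (hex k)
  choose g hg using hprim
  refine ⟨fun k ↦ if k ≤ N then ((g k : MForm 𝓘(ℝ, EM) M ℂ k)).restr W' else 0, fun k ↦ ?_, ?_⟩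
  · by_cases hk : k ≤ N
    · simp only [hk, if_true]
      exact restr_mem_smoothFormsOn hW'o (hW'V k hk) (g k).2
    · simp only [hk, if_false]; exact zero_mem _
  · funext k
    cases k with
    | zero =>
      change (0 : MForm 𝓘(ℝ, EM) M ℂ 0) = (f 0).restr W'
      have : (f 0).restr W' = ((f 0).restr V₀).restr W' := by
        rw [MForm.restr_restr, inter_eq_left.2 (inter_subset_left : W' ⊆ V₀)]
      rw [this, h0, MForm.restr_zero]
    | succ k =>
      change (mextDeriv (if k ≤ N then ((g k : MForm 𝓘(ℝ, EM) M ℂ k)).restr W' else 0)).restr W' =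
        (f (k + 1)).restr W'
      by_cases hk : k ≤ N
      · simp only [hk, if_true]
        funext x
        by_cases hx : x ∈ W'
        · rw [MForm.restr_apply_of_mem _ hx, MForm.restr_apply_of_mem _ hx,
            mextDeriv_restr_apply hW'o _ hx]
          have := congrFun (hg k) x
          rw [coe_localD, MForm.restr_apply_of_mem _ (hW'V k hk hx),
            MForm.restr_apply_of_mem _ (hW'V k hk hx)] at this
          exact this
        · rw [MForm.restr_apply_of_notMem _ hx, MForm.restr_apply_of_notMem _ hx]
      · simp only [hk, if_false]
        rw [mextDeriv_zero, MForm.restr_zero,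
          mform_eq_zero_of_finrank_lt (I := 𝓘(ℝ, EM)) (show N < k + 1 by omega) (f (k + 1)), MForm.restr_zero]

omit [LinearOrder ι] in
include hinj in
/-- **Tautness II, ungraded.** Every `d`-closed smooth ungraded form `ζ` on `P I` is, up to `d` of a
smooth ungraded form, the pull-back of a closed ungraded form living on an arbitrarily small open
neighbourhood of `emb I (P I)`. [cite: Spanier1981, Ch. 6 §1, Thm. 10] [cite: Bredon1993, Thm. V.9.5] -/
theorem taut₂_emb (I : Finset ι) {W : Set M} (hW : IsOpen W) (hKW : range (T.emb I) ⊆ W)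
    (ζ : UForm 𝓘(ℝ, EP I) (P I) ℂ) (hζ : ∀ k, IsSmoothForm (ζ k)) (hdζ : UForm.d ζ = 0) :
    ∃ W' : Set M, IsOpen W' ∧ range (T.emb I) ⊆ W' ∧ W' ⊆ W ∧
      ∃ f : UForm 𝓘(ℝ, EM) M ℂ, UForm.IsSmoothOn W' f ∧ UForm.D W' f = 0 ∧
        ∃ ε : UForm 𝓘(ℝ, EP I) (P I) ℂ, (∀ k, IsSmoothForm (ε k)) ∧
          ∀ k, (f k).pullback 𝓘(ℝ, EP I) (T.emb I) = ζ k + UForm.d ε k := by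
  haveI : FiniteDimensional ℝ EM := FiniteDimensional.complexToReal EM
  haveI : FiniteDimensional ℝ (EP I) := FiniteDimensional.complexToReal (EP I)
  have hemb := T.isEmbedding_emb hinj I
  have hclosed : ∀ k, ζ k ∈ closedSmoothForms 𝓘(ℝ, EP I) (P I) ℂ k := fun k ↦
    ⟨hζ k, by have := congrFun hdζ (k + 1); exact this⟩
  -- degree `0`
  obtain ⟨V₀, hV₀o, hV₀W, hKV₀, θ₀, hθ₀, he₀⟩ :=
    exists_nhd_pullback_eq_complex (T.contMDiff_emb I) hemb hW hKW (hclosed 0)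
  -- positive degrees
  have hpos : ∀ k : ℕ, ∃ (V : Set M) (_ : IsOpen V), V ⊆ W ∧ range (T.emb I) ⊆ V ∧
      ∃ θ ∈ localClosedForms 𝓘(ℝ, EM) ℂ (k + 1) V, ∃ κ : MForm 𝓘(ℝ, EP I) (P I) ℂ k,
        IsSmoothForm κ ∧ θ.pullback 𝓘(ℝ, EP I) (T.emb I) = ζ (k + 1) + mextDeriv κ := fun k ↦
    exists_nhd_pullback_eq_add_mextDeriv_complex (T.contMDiff_emb I) hemb hW hKW (hclosed (k + 1))
  choose V hVo hVW hKV θ hθ κ hκ he using hpos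
  set N : ℕ := Module.finrank ℝ (EP I) with hN
  set W' : Set M := V₀ ∩ ⋂ k ∈ Finset.range (N + 1), V k with hW'
  have hW'o : IsOpen W' := hV₀o.inter (isOpen_biInter_finset fun k _ ↦ hVo k)
  have hW'V : ∀ k, k ≤ N → W' ⊆ V k := fun k hk ↦
    inter_subset_right.trans (biInter_subset_of_mem (Finset.mem_range.2 (Nat.lt_succ_of_le hk)))
  have hKW' : range (T.emb I) ⊆ W' := subset_inter hKV₀ (subset_iInter₂ fun k _ ↦ hKV k)
  have hyW' : ∀ y, T.emb I y ∈ W' := fun y ↦ hKW' ⟨y, rfl⟩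
  refine ⟨W', hW'o, hKW', inter_subset_left.trans hV₀W, ?_⟩
  -- the closed ungraded form on `W'`
  let f : UForm 𝓘(ℝ, EM) M ℂ := fun k ↦
    match k with
    | 0 => θ₀.restr W'
    | k + 1 => if k ≤ N then (θ k).restr W' else 0
  have hf0 : f 0 = θ₀.restr W' := rfl
  have hfs : ∀ k, f (k + 1) = if k ≤ N then (θ k).restr W' else 0 := fun k ↦ rfl
  have hfsm : UForm.IsSmoothOn W' f := by
    intro k
    cases k with
    | zero => rw [hf0]; exact restr_mem_smoothFormsOn hW'o inter_subset_left hθ₀.1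
    | succ k =>
      rw [hfs]
      by_cases hk : k ≤ N
      · simp only [hk, if_true]; exact restr_mem_smoothFormsOn hW'o (hW'V k hk) (hθ k).1
      · simp only [hk, if_false]; exact zero_mem _
  refine ⟨f, hfsm, ?_, ?_⟩
  · -- `D_{W'} f = 0`
    funext k
    cases k with
    | zero => rfl
    | succ k =>
      change (mextDeriv (f k)).restr W' = 0
      funext x
      by_cases hx : x ∈ W'
      · rw [MForm.restr_apply_of_mem _ hx]
        cases k with
        | zero =>
          rw [hf0, mextDeriv_restr_apply hW'o _ hx]
          exact hθ₀.2 x (inter_subset_left hx)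
        | succ k =>
          rw [hfs]
          by_cases hk : k ≤ N
          · simp only [hk, if_true]
            rw [mextDeriv_restr_apply hW'o _ hx]
            exact (hθ k).2 x (hW'V k hk hx)
          · simp only [hk, if_false]
            rw [mextDeriv_zero]
      · rw [MForm.restr_apply_of_notMem _ hx]
        rfl
  · -- the correction `ε` and the identity `emb^* f = ζ + d ε`
    refine ⟨fun k ↦ if k + 1 ≤ N then κ k else 0, fun k ↦ ?_, fun k ↦ ?_⟩
    · by_cases hk : k + 1 ≤ N
      · simp only [hk, if_true]; exact hκ k
      · simp only [hk, if_false]; exact isSmoothForm_zero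
    · cases k with
      | zero =>
        rw [hf0, MForm.pullback_restr_of_forall_mem hyW', he₀, UForm.d_zero_apply, add_zero]
      | succ k =>
        rw [hfs, UForm.d_succ_apply]
        by_cases hk : k + 1 ≤ N
        · have hk' : k ≤ N := by omega
          simp only [hk', hk, if_true]
          rw [MForm.pullback_restr_of_forall_mem hyW', he]
        · simp only [hk, if_false]
          rw [mextDeriv_zero, add_zero,
            mform_eq_zero_of_finrank_lt (I := 𝓘(ℝ, EP I)) (show N < k + 1 by omega) (ζ (k + 1))]
          by_cases hk' : k ≤ N
          · -- `k = N`: the degree-`(N+1)` forms on `P I` vanish, so does the pull-back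
            simp only [hk', if_true]
            exact mform_eq_zero_of_finrank_lt (I := 𝓘(ℝ, EP I)) (show N < k + 1 by omega) _
          · simp only [hk', if_false]
            exact MForm.pullback_zero _

end Taut

/-! #### The system -/

section System

/-- Real scalars act on complex forms through `ℝ ⊆ ℂ`. [folklore] -/
theorem mform_real_smul_eq_coe_smul {E : Type*} [NormedAddCommGroup E]
    [NormedSpace ℂ E] {N : Type*} [TopologicalSpace N] [ChartedSpace E N] {k : ℕ} (r : ℝ)
    (α : MForm 𝓘(ℝ, E) N ℂ k) : r • α = (r : ℂ) • α := by
  funext x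
  ext v
  simp

omit [FiniteDimensional ℂ EM] [IsManifold 𝓘(ℝ, EM) ∞ M] [CompactSpace M] [T2Space M]
  [SecondCountableTopology M] [∀ (I : Finset ι), FiniteDimensional ℂ (EP I)]
 
  [∀ (I : Finset ι), IsManifold 𝓘(ℝ, EP I) ∞ (P I)] [∀ (I : Finset ι), CompactSpace (P I)]
  [∀ (I : Finset ι), T2Space (P I)] [∀ (I : Finset ι), SecondCountableTopology (P I)] in
/-- `germR` only depends on the pull-backs of the components. [folklore] -/
theorem germR_congr {p : ℕ} (J : Fin p → ι) {f g : UForm 𝓘(ℝ, EM) M ℂ}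
    (e : ∀ k, (f k).pullback 𝓘(ℝ, EP (tupleSupport J)) (T.emb (tupleSupport J)) =
      (g k).pullback 𝓘(ℝ, EP (tupleSupport J)) (T.emb (tupleSupport J))) :
    T.germR J f = T.germR J g := by
  classical
  unfold germR
  by_cases hf : ∀ k, IsSmoothForm ((f k).pullback 𝓘(ℝ, EP (tupleSupport J)) (T.emb (tupleSupport J)))
  · have hg : ∀ k, IsSmoothForm ((g k).pullback 𝓘(ℝ, EP (tupleSupport J)) (T.emb (tupleSupport J))) :=
      fun k ↦ e k ▸ hf k
    rw [dif_pos hf, dif_pos hg]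
    exact Subtype.ext (funext e)
  · have hg : ¬ ∀ k, IsSmoothForm ((g k).pullback 𝓘(ℝ, EP (tupleSupport J)) (T.emb (tupleSupport J))) :=
      fun hg ↦ hf fun k ↦ e k ▸ hg k
    rw [dif_neg hf, dif_neg hg]

omit [FiniteDimensional ℂ EM] [IsManifold 𝓘(ℝ, EM) ∞ M] [CompactSpace M] [T2Space M]
  [SecondCountableTopology M] [∀ (I : Finset ι), FiniteDimensional ℂ (EP I)]
 
  [∀ (I : Finset ι), IsManifold 𝓘(ℝ, EP I) ∞ (P I)] [∀ (I : Finset ι), CompactSpace (P I)]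
  [∀ (I : Finset ι), T2Space (P I)] [∀ (I : Finset ι), SecondCountableTopology (P I)] in
/-- The range of the stratum of a positive-length tuple lies in the intersection of the ranges of
the strata of its entries. [folklore] -/
theorem range_emb_tupleSupport_subset {p : ℕ} (J : Fin p → ι) :
    range (T.emb (tupleSupport J)) ⊆ ⋂ m, range (T.emb {J m}) :=
  subset_iInter fun m ↦ T.range_emb_subset (singleton_subset_tupleSupport J m)

variable (hrange : ∀ I : Finset ι, I.Nonempty → range (T.emb I) = ⋂ i ∈ I, range (T.emb {i}))

omit [FiniteDimensional ℂ EM] [IsManifold 𝓘(ℝ, EM) ∞ M] [CompactSpace M] [T2Space M]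
  [SecondCountableTopology M] [∀ I, FiniteDimensional ℂ (EP I)]
  [∀ I, IsManifold 𝓘(ℝ, EP I) ∞ (P I)]
  [∀ I, CompactSpace (P I)] [∀ I, T2Space (P I)] [∀ I, SecondCountableTopology (P I)] in
include hrange in
/-- Under the intersection hypothesis, the range of the stratum of a positive-length tuple IS the
intersection of the ranges of the strata of its entries. [folklore] -/
theorem range_emb_tupleSupport {p : ℕ} (J : Fin (p + 1) → ι) :
    range (T.emb (tupleSupport J)) = ⋂ m, range (T.emb {J m}) := by
  refine subset_antisymm (T.range_emb_tupleSupport_subset J) ?_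
  rw [hrange _ ⟨J 0, mem_tupleSupport J 0⟩]
  refine subset_iInter₂ fun i hi ↦ ?_
  obtain ⟨m, -, rfl⟩ := Finset.mem_image.1 hi
  exact iInter_subset _ m

include hinj hrange in
/-- **The germ Čech system of an embedded strata system** with compact Kähler… (here: compact)
strata whose higher strata are the intersections of the codimension-one ones: pieces
`K_i = emb(P {i})`, forms `T_J` = smooth ungraded complex forms on `P (tupleSupport J)`,
`res` / `r` = pull-back along `res` / `emb`, `d` the exterior derivative, and the two tautness
properties `taut₁_emb`, `taut₂_emb`. [cite: BottTu1982Forms, §8 (8.1)–(8.5)]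
[cite: Spanier1981, Ch. 6 §1, Thm. 10] -/
def germCechSystem : GermCechSystem 𝓘(ℝ, EM) M ℂ ι where
  K i := range (T.emb {i})
  isCompact_K i := isCompact_range (T.contMDiff_emb _).continuous
  T := fun _ J ↦ TT EP P J
  res := fun _ _ J' J θ h ↦ T.germRes J' J θ h
  d := fun _ _ ↦ smoothUForms.dS
  r := fun _ J f ↦ T.germR J f
  res_self := fun _ J θ h _ z ↦ smoothUForms.pullbackS_id _ (T.res_self _ _) z
  res_res := fun _ _ _ J'' J' J θ θ' h h' h'' z ↦ by
    change smoothUForms.pullbackS _ (smoothUForms.pullbackS _ z) = smoothUForms.pullbackS _ z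
    rw [smoothUForms.pullbackS_pullbackS]
    exact smoothUForms.pullbackS_congr _ _ (T.res_comp_res _ _) z
  res_d := fun _ _ J' J θ h z ↦ smoothUForms.pullbackS_dS _ z
  res_r := fun p q J' J θ h W hW hKW f hf ↦ by
    have hJ'W : range (T.emb (tupleSupport J')) ⊆ W := (T.range_emb_tupleSupport_subset J').trans hKW
    have hsub : tupleSupport J' ⊆ tupleSupport J := tupleSupport_subset_of_eq h
    have hJW : range (T.emb (tupleSupport J)) ⊆ W := (T.range_emb_subset hsub).trans hJ'W
    have hf' := fun k ↦ T.isSmoothForm_pullback_emb_of_smoothAt hJ'W (hf k)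
    have hf'' := fun k ↦ T.isSmoothForm_pullback_emb_of_smoothAt hJW (hf k)
    rw [T.germR_of_smooth J' hf', T.germR_of_smooth J hf'']
    refine Subtype.ext (funext fun k ↦ ?_)
    change ((f k).pullback _ (T.emb (tupleSupport J'))).pullback _ (T.res hsub) = (f k).pullback _ _
    rw [MForm.pullback_pullback_of_mdifferentiable _ ((T.contMDiff_emb _).mdifferentiable (by simp))
      ((T.contMDiff_res hsub).mdifferentiable (by simp)), T.emb_comp_res hsub]
  r_add := fun p J W hW hKW f g hf hg ↦ by
    have hJW : range (T.emb (tupleSupport J)) ⊆ W := (T.range_emb_tupleSupport_subset J).trans hKW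
    have hf' := fun k ↦ T.isSmoothForm_pullback_emb_of_smoothAt hJW (hf k)
    have hg' := fun k ↦ T.isSmoothForm_pullback_emb_of_smoothAt hJW (hg k)
    have hfg' : ∀ k, IsSmoothForm (((f + g) k).pullback 𝓘(ℝ, EP (tupleSupport J)) (T.emb (tupleSupport J))) :=
      fun k ↦ by rw [Pi.add_apply, MForm.pullback_add]; exact (hf' k).add (hg' k)
    rw [T.germR_of_smooth J hf', T.germR_of_smooth J hg', T.germR_of_smooth J hfg']
    apply Subtype.ext
    funext k
    change ((f + g) k).pullback _ _ = (f k).pullback _ _ + (g k).pullback _ _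
    rw [Pi.add_apply, MForm.pullback_add]
  r_sub := fun p J W hW hKW f g hf hg ↦ by
    have hJW : range (T.emb (tupleSupport J)) ⊆ W := (T.range_emb_tupleSupport_subset J).trans hKW
    have hf' := fun k ↦ T.isSmoothForm_pullback_emb_of_smoothAt hJW (hf k)
    have hg' := fun k ↦ T.isSmoothForm_pullback_emb_of_smoothAt hJW (hg k)
    have hfg' : ∀ k, IsSmoothForm (((f - g) k).pullback 𝓘(ℝ, EP (tupleSupport J)) (T.emb (tupleSupport J))) :=
      fun k ↦ by rw [Pi.sub_apply, mform_pullback_sub]; exact (hf' k).sub (hg' k)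
    rw [T.germR_of_smooth J hf', T.germR_of_smooth J hg', T.germR_of_smooth J hfg']
    apply Subtype.ext
    funext k
    change ((f - g) k).pullback _ _ = (f k).pullback _ _ - (g k).pullback _ _
    rw [Pi.sub_apply, mform_pullback_sub]
  r_D := fun p J W hW hKW f hf ↦ by
    have hJW : range (T.emb (tupleSupport J)) ⊆ W := (T.range_emb_tupleSupport_subset J).trans hKW
    have hyW : ∀ y, T.emb (tupleSupport J) y ∈ W := fun y ↦ hJW ⟨y, rfl⟩
    have hf' := fun k ↦ T.isSmoothForm_pullback_emb_of_smoothAt hJW (hf k).1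
    -- the pull-backs of `D_W f` are the derivatives of the pull-backs
    have he : ∀ k, (UForm.D W f k).pullback 𝓘(ℝ, EP (tupleSupport J)) (T.emb (tupleSupport J)) =
        UForm.d (fun k ↦ (f k).pullback 𝓘(ℝ, EP (tupleSupport J)) (T.emb (tupleSupport J))) k := by
      intro k
      cases k with
      | zero => exact MForm.pullback_zero _
      | succ k =>
        change ((mextDeriv (f k)).restr W).pullback _ _ = mextDeriv ((f k).pullback _ _)
        rw [MForm.pullback_restr_of_forall_mem hyW]
        funext y
        exact (mextDeriv_pullback_apply (Filter.Eventually.of_forall fun z ↦ (T.contMDiff_emb _ z))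
          ((hf k).1 _ (hyW y))).symm
    have hD' : ∀ k, IsSmoothForm ((UForm.D W f k).pullback 𝓘(ℝ, EP (tupleSupport J)) (T.emb (tupleSupport J))) := by
      intro k; rw [he]
      cases k with
      | zero => exact isSmoothForm_zero
      | succ k => exact isSmoothForm_mextDeriv (inChart_mextDeriv_holds _ _ _) (hf' k)
    rw [T.germR_of_smooth J hf', T.germR_of_smooth J hD']
    apply Subtype.ext
    funext k
    exact he k
  r_local := fun p J W hW hKW f g hfg ↦ by
    have hJW : range (T.emb (tupleSupport J)) ⊆ W := (T.range_emb_tupleSupport_subset J).trans hKW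
    exact T.germR_congr J fun k ↦ MForm.pullback_congr_of_forall_range fun y ↦ hfg k _ (hJW ⟨y, rfl⟩)
  taut₁ := fun p J W hW hKW f hf hdf hex ↦ by
    have hJW : range (T.emb (tupleSupport J)) ⊆ W := (T.range_emb_tupleSupport_subset J).trans hKW
    obtain ⟨ζ, hζ⟩ := hex
    have hf' := fun k ↦ T.isSmoothForm_pullback_emb_of_smoothAt hJW (hf k).1
    have he : ∀ k, (f k).pullback 𝓘(ℝ, EP (tupleSupport J)) (T.emb (tupleSupport J)) = UForm.d ζ.1 k := by
      intro k
      have := congrArg (fun z : TT EP P J ↦ z.1 k) hζ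
      simpa only [T.germR_of_smooth J hf', smoothUForms.coe_dS] using this
    obtain ⟨W', hW'o, hKW', hW'W, hexact⟩ := T.taut₁_emb hinj (tupleSupport J) hW hJW hf hdf ζ ζ.2 he
    exact ⟨W', hW'o, (T.range_emb_tupleSupport hrange J) ▸ hKW', hW'W, hexact⟩
  taut₂ := fun p J W hW hKW ζ hdζ ↦ by
    have hJW : range (T.emb (tupleSupport J)) ⊆ W := (T.range_emb_tupleSupport_subset J).trans hKW
    have hdζ' : UForm.d ζ.1 = 0 := congrArg Subtype.val hdζ
    obtain ⟨W', hW'o, hKW', hW'W, f, hf, hDf, ε, hε, he⟩ :=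
      T.taut₂_emb hinj (tupleSupport J) hW hJW ζ ζ.2 hdζ'
    refine ⟨W', hW'o, (T.range_emb_tupleSupport hrange J) ▸ hKW', hW'W, f, hf, hDf, ⟨ε, hε⟩, ?_⟩
    have hsm : ∀ k, IsSmoothForm ((f k).pullback 𝓘(ℝ, EP (tupleSupport J)) (T.emb (tupleSupport J))) := by
      intro k; rw [he k]
      refine (ζ.2 k).add ?_
      cases k with
      | zero => exact isSmoothForm_zero
      | succ k => exact isSmoothForm_mextDeriv (inChart_mextDeriv_holds _ _ _) (hε k)
    rw [T.germR_of_smooth J hsm]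
    apply Subtype.ext
    funext k
    exact he k

/-- The pieces of the germ Čech system. [folklore] -/
@[simp] theorem germCechSystem_K (i : ι) : (T.germCechSystem hinj hrange).K i = range (T.emb {i}) := rfl

end System

/-! ### §3 From a descent tower to exactness near the union of the strata -/

section Tower

variable [Fintype ι] [∀ I, IsManifold 𝓘(ℂ, EP I) ω (P I)]
  (hrange : ∀ I : Finset ι, I.Nonempty → range (T.emb I) = ⋂ i ∈ I, range (T.emb {i}))

/-- The signs converting the descent equations `δ η_a + (-1)^{a+1} d η_{a+1} = 0` of
`StrataDDbarDescent` into the tower equations `δ η'_a = d η'_{a+1}` of `GermCechDescent`: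
`s₀ = 1`, `s_{a+1} = (-1)^a s_a`. [folklore] -/
def towerSign : ℕ → ℂ
  | 0 => 1
  | a + 1 => (-1) ^ a * towerSign a

omit [Fintype ι] [∀ I, IsManifold 𝓘(ℂ, EP I) ω (P I)] in
/-- The Čech differential of the germ Čech system of `T`, in a degree: it is `T.delta` up to the
real/complex bookkeeping of the signs. [cite: BottTu1982Forms, §8 (8.4)] -/
theorem germCechSystem_cechδ_apply {a : ℕ} (c : ∀ J : Fin (a + 1) → ι, TT EP P J) (K : Fin (a + 2) → ι)
    (m : ℕ) :
    (show TT EP P K from (T.germCechSystem hinj hrange).cechδ c K).1 m =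
      T.delta (fun J ↦ (c J).1 m) K := by
  rw [GermCechSystem.cechδ, delta_apply, Submodule.coe_sum, Finset.sum_apply]
  refine Finset.sum_congr rfl fun b _ ↦ ?_
  rw [Submodule.coe_smul, Pi.smul_apply, mform_real_smul_eq_coe_smul]
  push_cast
  rfl

variable {k p q : ℕ} {x : MForm 𝓘(ℝ, EM) M ℂ (k + 1 + 1)}
  (hxs : IsSmoothForm x) (hxt : IsOfType (p + 1) (q + 1) x)
  (hx : ∀ J : Fin 1 → ι, ∃ α : MForm 𝓘(ℝ, EP (tupleSupport J)) (P (tupleSupport J)) ℂ (k + 1),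
    IsSmoothForm α ∧ T.sres x J = mextDeriv α)

variable [∀ I, IsKaehlerManifold (EP I) (P I)]

/-- **The descent tower of `StrataDDbarDescent` as a tower of the germ Čech system**: in level `a`
the ungraded form with the single component `s_a • η_{a, k+1-a}`. [cite: DeligneGriffithsMorganSullivan1975, §5] -/
def etaTower (a : ℕ) (J : Fin (a + 1) → ι) : TT EP P J :=
  ⟨fun m ↦ if a + m = k + 1 then towerSign a • T.eta hxs hxt hx a m J else 0, fun m ↦ by
    by_cases h : a + m = k + 1
    · simp only [h, if_true]; exact (T.eta_smooth hxs hxt hx a m J).smul_complex _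
    · simp only [h, if_false]; exact isSmoothForm_zero⟩

omit [FiniteDimensional ℂ EM] [CompactSpace M] [T2Space M] [SecondCountableTopology M]
  [∀ (I : Finset ι), SecondCountableTopology (P I)] [Fintype ι] in
/-- The components of the tower. [folklore] -/
theorem etaTower_apply (a : ℕ) (J : Fin (a + 1) → ι) (m : ℕ) :
    (T.etaTower hxs hxt hx a J).1 m = if a + m = k + 1 then towerSign a • T.eta hxs hxt hx a m J else 0 :=
  rfl

omit [LinearOrder ι] [FiniteDimensional ℂ EM] [CompactSpace M] [T2Space M]
  [SecondCountableTopology M] [∀ (I : Finset ι), CompactSpace (P I)]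
  [∀ (I : Finset ι), T2Space (P I)] [∀ (I : Finset ι), SecondCountableTopology (P I)] [Fintype ι]
  [∀ (I : Finset ι), IsKaehlerManifold (EP I) (P I)]
  [∀ I, FiniteDimensional ℂ (EP I)] [∀ I, IsManifold 𝓘(ℂ, EP I) ω (P I)] in
include hxs in
/-- The pull-backs of `single (k+2) x` along `emb` are smooth. [folklore] -/
theorem isSmoothForm_pullback_single (I : Finset ι) (m : ℕ) :
    IsSmoothForm ((UForm.single (k + 1 + 1) x m).pullback 𝓘(ℝ, EP I) (T.emb I)) := by
  by_cases h : k + 1 + 1 = m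
  · subst h
    rw [UForm.single_apply_self]
    exact isSmoothForm_pullback (T.contMDiff_emb I) hxs
  · rw [UForm.single_apply_of_ne h, MForm.pullback_zero]
    exact isSmoothForm_zero

omit [FiniteDimensional ℂ EM] [CompactSpace M] [T2Space M] [SecondCountableTopology M]
  [∀ I, SecondCountableTopology (P I)] [Fintype ι] in
/-- **Level `0` of the tower: `d η'₀ = r x`.** [cite: DeligneGriffithsMorganSullivan1975, §5] -/
theorem dS_etaTower_zero (J : Fin 1 → ι) :
    smoothUForms.dS (T.etaTower hxs hxt hx 0 J) = T.germR J (UForm.single (k + 1 + 1) x) := by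
  rw [T.germR_of_smooth J (T.isSmoothForm_pullback_single hxs _)]
  refine Subtype.ext (funext fun m ↦ ?_)
  change UForm.d (T.etaTower hxs hxt hx 0 J).1 m = _
  cases m with
  | zero =>
    change (0 : MForm _ _ ℂ 0) = (UForm.single (k + 1 + 1) x 0).pullback _ (T.emb (tupleSupport J))
    rw [UForm.single_apply_of_ne (by omega), MForm.pullback_zero]
  | succ m =>
    change mextDeriv ((T.etaTower hxs hxt hx 0 J).1 m) =
      (UForm.single (k + 1 + 1) x (m + 1)).pullback _ (T.emb (tupleSupport J))
    rw [etaTower_apply]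
    by_cases h : 0 + m = k + 1
    · have hm : m = k + 1 := by omega
      subst hm
      simp only [h, if_true, towerSign, one_smul]
      rw [T.mextDeriv_eta_zero hxs hxt hx J, UForm.single_apply_self]
      rfl
    · simp only [h, if_false]
      rw [mextDeriv_zero, UForm.single_apply_of_ne (by omega), MForm.pullback_zero]

omit [Fintype ι] in
/-- **The higher levels of the tower: `δ η'_a = d η'_{a+1}`.** [cite: DeligneGriffithsMorganSullivan1975, §5] -/
theorem cechδ_etaTower (a : ℕ) (K : Fin (a + 2) → ι) :
    (T.germCechSystem hinj hrange).cechδ (T.etaTower hxs hxt hx a) K =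
      smoothUForms.dS (T.etaTower hxs hxt hx (a + 1) K) := by
  refine Subtype.ext (funext fun m ↦ ?_)
  rw [T.germCechSystem_cechδ_apply hinj hrange]
  change T.delta (fun J ↦ (T.etaTower hxs hxt hx a J).1 m) K = UForm.d (T.etaTower hxs hxt hx (a + 1) K).1 m
  simp only [etaTower_apply]
  by_cases h : a + m = k + 1
  · simp only [h, if_true]
    cases m with
    | zero =>
      -- `η_{a, 0} = 0`
      rw [UForm.d_zero_apply, T.eta_zero_right hxs hxt hx a]
      simp only [Pi.zero_apply, smul_zero]
      exact congrFun T.delta_zero K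
    | succ m =>
      rw [UForm.d_succ_apply, etaTower_apply]
      have h' : a + 1 + m = k + 1 := by omega
      simp only [h', if_true]
      rw [show (fun J : Fin (a + 1) → ι ↦ towerSign a • T.eta hxs hxt hx a (m + 1) J) =
          towerSign a • T.eta hxs hxt hx a (m + 1) from rfl, T.delta_smul,
        mextDeriv_smul_complex_holds, towerSign]
      have hrel := T.delta_eta_add hxs hxt hx a m (by omega) K
      rw [add_eq_zero_iff_eq_neg] at hrel
      rw [Pi.smul_apply, hrel, smul_neg, ← neg_smul, smul_smul]
      congr 1
      ring
  · simp only [h, if_false]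
    cases m with
    | zero => rw [UForm.d_zero_apply]; exact congrFun T.delta_zero K
    | succ m =>
      rw [UForm.d_succ_apply, etaTower_apply]
      have h' : ¬ (a + 1 + m = k + 1) := by omega
      simp only [h', if_false]
      rw [mextDeriv_zero]
      exact congrFun T.delta_zero K

include hinj hrange hxs hxt hx in
/-- **A closed form of pure type `(p+1, q+1)` whose restrictions to the strata `P {i}` are exact
is exact near `⋃ i, emb(P {i})`** (compact Kähler strata embedded in the compact complex manifold
`M`, higher strata = intersections): the `∂∂̄`-descent tower (`StrataDDbarDescent`) fed to the
germ Čech descent (`GermCechSystem.exists_isExactOn`). This is the analytic heart of the direct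
route to Deligne's Hodge III, Prop. 8.2.7 / Cor. 8.2.8. [cite: DeligneGriffithsMorganSullivan1975, §§5–6]
[cite: DeligneHodgeIII1974, Prop. 8.2.7] [cite: BottTu1982Forms, Prop. 8.8] -/
theorem exists_nhd_restr_mem_localExactForms_of_isOfType (hxc : IsClosedForm x) :
    ∃ (V : Set M) (hV : IsOpen V), (∀ i, range (T.emb {i}) ⊆ V) ∧
      x.restr V ∈ localExactForms 𝓘(ℝ, EM) ℂ hV (k + 1 + 1) := by
  haveI : FiniteDimensional ℝ EM := FiniteDimensional.complexToReal EM
  set S := T.germCechSystem hinj hrange with hS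
  -- the ambient closed ungraded form
  have hα : UForm.IsSmoothOn univ (UForm.single (k + 1 + 1) x) := fun m ↦
    ⟨fun y _ ↦ by
      by_cases h : k + 1 + 1 = m
      · subst h; rw [UForm.single_apply_self]; exact hxs y
      · rw [UForm.single_apply_of_ne h]; exact MForm.smoothAt_zero y,
     fun y hy ↦ absurd (mem_univ y) hy⟩
  have hdα : UForm.D univ (UForm.single (k + 1 + 1) x) = 0 := by
    rw [UForm.D_univ]
    funext m
    cases m with
    | zero => rfl
    | succ m =>
      rw [UForm.d_succ_apply]
      by_cases h : k + 1 + 1 = m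
      · subst h; rw [UForm.single_apply_self]; exact hxc
      · rw [UForm.single_apply_of_ne h, mextDeriv_zero]; rfl
  obtain ⟨V, hVo, hKV, -, τ, hτ, hDτ⟩ := GermCechSystem.exists_isExactOn S Finset.univ isOpen_univ
    (fun i _ ↦ subset_univ _) hα hdα (fun a J ↦ T.etaTower hxs hxt hx a J)
    (fun J _ ↦ T.dS_etaTower_zero hxs hxt hx J) (fun a K _ ↦ T.cechδ_etaTower hinj hrange hxs hxt hx a K)
  refine ⟨V, hVo, fun i ↦ hKV i (Finset.mem_univ i), ?_⟩
  rw [mem_localExactForms_succ_iff]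
  refine ⟨⟨τ (k + 1), hτ (k + 1)⟩, ?_⟩
  have := congrFun hDτ (k + 1 + 1)
  rw [coe_localD]
  change UForm.D V τ (k + 1 + 1) = _ at this
  rw [UForm.D_succ_apply] at this
  rw [this, UForm.restr_apply, UForm.single_apply_self]

end Tower

/-! ### §4 The zero tower: forms whose restrictions to the strata vanish -/

section Zero

variable [Fintype ι]
  (hrange : ∀ I : Finset ι, I.Nonempty → range (T.emb I) = ⋂ i ∈ I, range (T.emb {i}))

include hinj hrange in
/-- **A closed form whose restrictions to the strata `P {i}` vanish is exact near
`⋃ i, emb(P {i})`** (ungraded form; the zero tower). [cite: BottTu1982Forms, Prop. 8.8]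
[cite: Spanier1981, Ch. 6 §1, Thm. 10] -/
theorem exists_nhd_isExactOn_of_sres_eq_zero {n : ℕ} {x : MForm 𝓘(ℝ, EM) M ℂ n} (hxs : IsSmoothForm x)
    (hxc : IsClosedForm x) (hx0 : ∀ J : Fin 1 → ι, T.sres x J = 0) :
    ∃ V : Set M, IsOpen V ∧ (∀ i, range (T.emb {i}) ⊆ V) ∧
      ∃ τ : UForm 𝓘(ℝ, EM) M ℂ, UForm.IsSmoothOn V τ ∧ UForm.D V τ = UForm.restr V (UForm.single n x) := by
  haveI : FiniteDimensional ℝ EM := FiniteDimensional.complexToReal EM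
  set S := T.germCechSystem hinj hrange with hS
  have hα : UForm.IsSmoothOn univ (UForm.single n x) := fun m ↦
    ⟨fun y _ ↦ by
      by_cases h : n = m
      · subst h; rw [UForm.single_apply_self]; exact hxs y
      · rw [UForm.single_apply_of_ne h]; exact MForm.smoothAt_zero y,
     fun y hy ↦ absurd (mem_univ y) hy⟩
  have hdα : UForm.D univ (UForm.single n x) = 0 := by
    rw [UForm.D_univ]
    funext m
    cases m with
    | zero => rfl
    | succ m =>
      rw [UForm.d_succ_apply]
      by_cases h : n = m
      · subst h; rw [UForm.single_apply_self]; exact hxc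
      · rw [UForm.single_apply_of_ne h, mextDeriv_zero]; rfl
  -- the restrictions of `single n x` to the `1`-strata vanish
  have hsm : ∀ (J : Fin 1 → ι) (m : ℕ),
      IsSmoothForm ((UForm.single n x m).pullback 𝓘(ℝ, EP (tupleSupport J)) (T.emb (tupleSupport J))) := by
    intro J m
    by_cases h : n = m
    · subst h; rw [UForm.single_apply_self]; exact isSmoothForm_pullback (T.contMDiff_emb _) hxs
    · rw [UForm.single_apply_of_ne h, MForm.pullback_zero]; exact isSmoothForm_zero
  have hr0 : ∀ J : Fin 1 → ι, S.r J (UForm.single n x) = 0 := by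
    intro J
    change T.germR J _ = 0
    rw [T.germR_of_smooth J (hsm J)]
    refine Subtype.ext (funext fun m ↦ ?_)
    change (UForm.single n x m).pullback _ _ = 0
    by_cases h : n = m
    · subst h; rw [UForm.single_apply_self]; exact hx0 J
    · rw [UForm.single_apply_of_ne h, MForm.pullback_zero]
  obtain ⟨V, hVo, hKV, -, τ, hτ, hDτ⟩ := GermCechSystem.exists_isExactOn S Finset.univ isOpen_univ
    (fun i _ ↦ subset_univ _) hα hdα (fun a J ↦ (0 : TT EP P J))
    (fun J _ ↦ by rw [map_zero, hr0]) (fun a K _ ↦ by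
      rw [map_zero]
      have := S.cechδ_smul (0 : ℝ) (fun J : Fin (a + 1) → ι ↦ (0 : S.T J)) K
      simpa using this)
  exact ⟨V, hVo, fun i ↦ hKV i (Finset.mem_univ i), τ, hτ, hDτ⟩

include hinj hrange in
/-- **A closed form of positive degree whose restrictions to the strata vanish is exact near
`⋃ i, emb(P {i})`.** [cite: BottTu1982Forms, Prop. 8.8] [cite: Spanier1981, Ch. 6 §1, Thm. 10] -/
theorem exists_nhd_restr_mem_localExactForms_of_sres_eq_zero {n : ℕ} {x : MForm 𝓘(ℝ, EM) M ℂ (n + 1)}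
    (hxs : IsSmoothForm x) (hxc : IsClosedForm x) (hx0 : ∀ J : Fin 1 → ι, T.sres x J = 0) :
    ∃ (V : Set M) (hV : IsOpen V), (∀ i, range (T.emb {i}) ⊆ V) ∧
      x.restr V ∈ localExactForms 𝓘(ℝ, EM) ℂ hV (n + 1) := by
  obtain ⟨V, hVo, hKV, τ, hτ, hDτ⟩ := T.exists_nhd_isExactOn_of_sres_eq_zero hinj hrange hxs hxc hx0
  refine ⟨V, hVo, hKV, ?_⟩
  rw [mem_localExactForms_succ_iff]
  refine ⟨⟨τ n, hτ n⟩, ?_⟩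
  have := congrFun hDτ (n + 1)
  rw [coe_localD]
  change UForm.D V τ (n + 1) = _ at this
  rw [UForm.D_succ_apply] at this
  rw [this, UForm.restr_apply, UForm.single_apply_self]

include hinj hrange in
/-- **A closed `0`-form whose restrictions to the strata vanish vanishes near `⋃ i, emb(P {i})`.**
[cite: Spanier1981, Ch. 6 §1, Thm. 10] -/
theorem exists_nhd_restr_eq_zero_of_sres_eq_zero {x : MForm 𝓘(ℝ, EM) M ℂ 0}
    (hxs : IsSmoothForm x) (hxc : IsClosedForm x) (hx0 : ∀ J : Fin 1 → ι, T.sres x J = 0) :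
    ∃ V : Set M, IsOpen V ∧ (∀ i, range (T.emb {i}) ⊆ V) ∧ x.restr V = 0 := by
  obtain ⟨V, hVo, hKV, τ, hτ, hDτ⟩ := T.exists_nhd_isExactOn_of_sres_eq_zero hinj hrange hxs hxc hx0
  refine ⟨V, hVo, hKV, ?_⟩
  have := congrFun hDτ 0
  rw [UForm.D_zero_apply, UForm.restr_apply, UForm.single_apply_self] at this
  exact this.symm

end Zero

end StrataMaps

end Strata

end Literature.Geometry.Kaehler
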